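import Summits.AtomisticToContinuum.BoseEinsteinCondensation.Theorems.BECProbeMassFlowRecoilTransferL2SublatticeAtoms
import Literature.MathematicalPhysics.QuantumManyBody.PeriodicMaxFormTranslation
import HarnessLib

/-!
# Route `BECProbeMassFlow`, crux `RecoilTransfer` (stmt-AtomisticToContinuum-12311):
# bands of atoms; the group of diagonal translations on `L²((ℝ/ℤ)^{3M})`

Support file for the stub `stub_groundStatesTranslationInvariant` (D′α) of the crux `RecoilTransfer`
(route `BECProbeMassFlow`, line `registered`), sequel of `…RecoilTransferL2SublatticeAtoms.lean`.

* `atom_ae_eq_smul` — the **band** of an atom `h` of a sublattice `V ⊆ L²((ℝ/ℤ)^{3M})`: every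
  non-negative `q ∈ V` equals a multiple of `h` a.e. on `{h ≠ 0}` (the infima `q ⊓ (n h)` are multiples of
  `h`);
* `atom_ae_eq_zero_of_inner_eq_zero`, `atom_inner_absLp_eq_zero` — an element of `V` orthogonal to an atom
  vanishes a.e. on its support, so the orthogonal complement of an atom inside `V` is again closed under
  `|·|` (the induction step of the sequel file);
* the group law of the diagonal translations `translateLp b` of `PeriodicMaxFormTranslation.lean`
  (`translateLp_translateLp`, `translateLp_zero`, `translateLp_neg_translateLp`) and the **continuity of their
  matrix coefficients** `b ↦ ⟪ξ, T_b η⟫` (`continuous_inner_translateLp`: a uniformly absolutely convergent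
  series of characters, by Parseval and `inner_mFourierLp_translateLp`).

Tagged folklore.
-/

noncomputable section

namespace Summit.AtomisticToContinuum.BoseEinsteinCondensation.Theorems

open MeasureTheory Filter UnitAddTorus
open scoped ENNReal NNReal InnerProductSpace ComplexConjugate
open Literature.MathematicalPhysics.QuantumManyBody Literature.MathematicalPhysics.QuantumManyBody.BoseGas
open Literature.Analysis.FunctionSpaces Literature.Analysis.OperatorTheory

-- The measure on `ℝ/ℤ` is the Haar PROBABILITY measure, as in `PeriodicFormDomain.lean` and every maximal-form
-- file of the tree (`absLp`, `maxFormGroundStates`, `translateLp` live on `Lp ℂ 2 (volume : Measure (UnitAddTorus _))`).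
attribute [local instance] Literature.MathematicalPhysics.QuantumManyBody.BoseGas.formDomain_measureSpace
  Literature.MathematicalPhysics.QuantumManyBody.BoseGas.formDomain_isProbabilityMeasure
  Literature.MathematicalPhysics.QuantumManyBody.BoseGas.formDomain_isProbabilityMeasure_pi

/-- Local notation for `L²((ℝ/ℤ)^{3M})`, as in the tree files. -/
local notation "L2T " N':max => Lp ℂ 2 (volume : Measure (UnitAddTorus (Fin N' × Fin 3)))

/-- Local notation for the torus `(ℝ/ℤ)^{3M}`. -/
local notation "𝕋 " N':max => UnitAddTorus (Fin N' × Fin 3)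

variable {M : ℕ}

/-! ### Bands of atoms -/

/-- **The band of an atom**: a non-negative `q ∈ V` coincides on `{h ≠ 0}` with a multiple of the atom
`h` (the infima `q ⊓ (n h)`, `n ∈ ℕ`, are multiples `cₙ h` of `h`, and pointwise `min(|q|, n|h|) = |q|` for
`n` large). [folklore] -/
theorem atom_ae_eq_smul (V : Submodule ℂ (L2T M)) (hVa : ∀ f ∈ V, absLp f ∈ V) {h : L2T M}
    (hh : h ∈ V) (hh0 : h ≠ 0) (hha : absLp h = h)
    (hhe : ∀ k ∈ V, absLp k = k → (∃ C : ℝ, absLp ((C : ℂ) • h - k) = (C : ℂ) • h - k) → ∃ c : ℝ, k = (c : ℂ) • h)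
    {q : L2T M} (hq : q ∈ V) (hqa : absLp q = q) :
    ∃ c : ℝ, ∀ᵐ t ∂(volume : Measure (𝕋 M)), (h : 𝕋 M → ℂ) t ≠ 0 →
      (q : 𝕋 M → ℂ) t = (c : ℂ) * (h : 𝕋 M → ℂ) t := by
  have hc : ∀ n : ℕ, ∃ c : ℝ,
      ((2⁻¹ : ℂ) • (q + ((n : ℝ) : ℂ) • h - absLp (q - ((n : ℝ) : ℂ) • h)) : L2T M) = (c : ℂ) • h := fun n =>
    hhe _ (inf_smul_mem V hVa hq hh n) (absLp_inf_smul hqa hha n.cast_nonneg) ⟨n, absLp_smul_sub_inf hqa hha n⟩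
  choose c hc using hc
  -- pointwise: `min |q| (n |h|) = cₙ h` for all `n`, a.e.
  have hpt : ∀ᵐ t ∂(volume : Measure (𝕋 M)), ∀ n : ℕ,
      ((min ‖(q : 𝕋 M → ℂ) t‖ ((n : ℝ) * ‖(h : 𝕋 M → ℂ) t‖) : ℝ) : ℂ) = (c n : ℂ) * (h : 𝕋 M → ℂ) t := by
    rw [ae_all_iff]
    intro n
    filter_upwards [coeFn_inf_smul hqa hha (n : ℝ), Lp.coeFn_smul ((c n : ℝ) : ℂ) h] with t h1 h2
    rw [← h1, hc n, h2, Pi.smul_apply, smul_eq_mul]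
  have hP := hpt.and ((ae_exists_eq_ofReal_of_absLp_eq hqa).and (ae_exists_eq_ofReal_of_absLp_eq hha))
  -- a point `t₀` with `h t₀ ≠ 0` where all of this holds
  obtain ⟨t₀, ht₀, hP₀, ⟨a₀, ha₀, hq₀⟩, ⟨b₀, hb₀, hh₀⟩⟩ : ∃ t₀, (h : 𝕋 M → ℂ) t₀ ≠ 0 ∧
      (∀ n : ℕ, ((min ‖(q : 𝕋 M → ℂ) t₀‖ ((n : ℝ) * ‖(h : 𝕋 M → ℂ) t₀‖) : ℝ) : ℂ) = (c n : ℂ) * (h : 𝕋 M → ℂ) t₀) ∧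
      (∃ a : ℝ, 0 ≤ a ∧ (q : 𝕋 M → ℂ) t₀ = (a : ℂ)) ∧ (∃ b : ℝ, 0 ≤ b ∧ (h : 𝕋 M → ℂ) t₀ = (b : ℂ)) := by
    by_contra hcon
    refine hh0 (Lp.eq_zero_iff_ae_eq_zero.2 ?_)
    filter_upwards [hP] with t ht
    by_contra h0
    exact hcon ⟨t, h0, ht⟩
  have hb₀' : 0 < b₀ := lt_of_le_of_ne hb₀ (by
    rintro rfl
    exact ht₀ (by rw [hh₀, Complex.ofReal_zero]))
  refine ⟨a₀ / b₀, ?_⟩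
  filter_upwards [hP] with t ⟨hn, ⟨a, ha, hqt⟩, ⟨b, hb, hht⟩⟩ hne
  have hb' : 0 < b := lt_of_le_of_ne hb (by
    rintro rfl
    exact hne (by rw [hht, Complex.ofReal_zero]))
  obtain ⟨n, hn'⟩ := exists_nat_ge (max (a / b) (a₀ / b₀))
  have e1 := hn n
  have e2 := hP₀ n
  rw [hqt, hht, Complex.norm_real, Complex.norm_real, Real.norm_of_nonneg ha, Real.norm_of_nonneg hb,
    min_eq_left ((div_le_iff₀ hb').1 ((le_max_left _ _).trans hn'))] at e1
  rw [hq₀, hh₀, Complex.norm_real, Complex.norm_real, Real.norm_of_nonneg ha₀, Real.norm_of_nonneg hb₀,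
    min_eq_left ((div_le_iff₀ hb₀').1 ((le_max_right _ _).trans hn'))] at e2
  -- `e1 : a = cₙ b`, `e2 : a₀ = cₙ b₀`
  have e1' : a = c n * b := by exact_mod_cast e1
  have e2' : a₀ = c n * b₀ := by exact_mod_cast e2
  have hcn : c n = a₀ / b₀ := by rw [e2', mul_div_cancel_right₀ _ hb₀'.ne']
  rw [hqt, hht, ← hcn]
  exact_mod_cast e1'

/-- **Elements of `V` orthogonal to an atom vanish on its support.** Every `f ∈ V` is, on `{h ≠ 0}`, a
complex multiple `γ h` of the atom `h` (apply `atom_ae_eq_smul` to the four non-negative parts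
`(re f)^±`, `(im f)^±`), and `⟪h, f⟫ = γ ‖h‖²`. [folklore] -/
theorem atom_ae_eq_zero_of_inner_eq_zero (V : Submodule ℂ (L2T M)) (hVc : ∀ f ∈ V, conjLp f ∈ V)
    (hVa : ∀ f ∈ V, absLp f ∈ V) {h : L2T M} (hh : h ∈ V) (hh0 : h ≠ 0) (hha : absLp h = h)
    (hhe : ∀ k ∈ V, absLp k = k → (∃ C : ℝ, absLp ((C : ℂ) • h - k) = (C : ℂ) • h - k) → ∃ c : ℝ, k = (c : ℂ) • h)
    {f : L2T M} (hf : f ∈ V) (horth : ⟪h, f⟫_ℂ = 0) :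
    ∀ᵐ t ∂(volume : Measure (𝕋 M)), (h : 𝕋 M → ℂ) t ≠ 0 → (f : 𝕋 M → ℂ) t = 0 := by
  -- the four non-negative parts of `f`
  have hreV : reLp f ∈ V := by
    rw [reLp_eq]
    exact V.smul_mem _ (V.add_mem hf (hVc f hf))
  have himV : imLp f ∈ V := by
    rw [imLp_eq]
    exact V.smul_mem _ (V.sub_mem hf (hVc f hf))
  have hp : ∀ g ∈ V, conjLp g = g → posPartLp g ∈ V := fun g hg hgr => by
    rw [posPartLp_eq_of_conjLp_eq hgr]
    exact V.smul_mem _ (V.add_mem (hVa g hg) hg)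
  have hn : ∀ g ∈ V, conjLp g = g → negPartLp g ∈ V := fun g hg hgr => by
    rw [negPartLp_eq_of_conjLp_eq hgr]
    exact V.smul_mem _ (V.sub_mem (hVa g hg) hg)
  obtain ⟨c₁, hc₁⟩ := atom_ae_eq_smul V hVa hh hh0 hha hhe (hp _ hreV (conjLp_reLp f)) (absLp_posPartLp _)
  obtain ⟨c₂, hc₂⟩ := atom_ae_eq_smul V hVa hh hh0 hha hhe (hn _ hreV (conjLp_reLp f)) (absLp_negPartLp _)
  obtain ⟨c₃, hc₃⟩ := atom_ae_eq_smul V hVa hh hh0 hha hhe (hp _ himV (conjLp_imLp f)) (absLp_posPartLp _)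
  obtain ⟨c₄, hc₄⟩ := atom_ae_eq_smul V hVa hh hh0 hha hhe (hn _ himV (conjLp_imLp f)) (absLp_negPartLp _)
  -- so `f = γ h` on `{h ≠ 0}`
  set γ : ℂ := ((c₁ - c₂ : ℝ) : ℂ) + Complex.I * ((c₃ - c₄ : ℝ) : ℂ) with hγ
  have hfγ : ∀ᵐ t ∂(volume : Measure (𝕋 M)), (h : 𝕋 M → ℂ) t ≠ 0 → (f : 𝕋 M → ℂ) t = γ * (h : 𝕋 M → ℂ) t := by
    have h1 := reLp_add_I_smul_imLp f
    have h2 := posPartLp_sub_negPartLp (conjLp_reLp f)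
    have h3 := posPartLp_sub_negPartLp (conjLp_imLp f)
    filter_upwards [hc₁, hc₂, hc₃, hc₄, Lp.coeFn_add (reLp f) (Complex.I • imLp f), Lp.coeFn_smul Complex.I (imLp f),
      Lp.coeFn_sub (posPartLp (reLp f)) (negPartLp (reLp f)), Lp.coeFn_sub (posPartLp (imLp f)) (negPartLp (imLp f))]
      with t e1 e2 e3 e4 e5 e6 e7 e8 ht
    rw [h2] at e7
    rw [h3] at e8
    rw [h1] at e5
    rw [e5, Pi.add_apply, e6, Pi.smul_apply, e7, e8, Pi.sub_apply, Pi.sub_apply, e1 ht, e2 ht, e3 ht, e4 ht, hγ,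
      smul_eq_mul]
    push_cast
    ring
  -- `⟪h, f⟫ = γ ⟪h, h⟫`, so `γ = 0`
  have hinner : ⟪h, f⟫_ℂ = γ * ⟪h, h⟫_ℂ := by
    rw [L2.inner_def, L2.inner_def, ← integral_const_mul]
    refine integral_congr_ae ?_
    filter_upwards [hfγ] with t ht
    simp only [RCLike.inner_apply']
    by_cases h0 : (h : 𝕋 M → ℂ) t = 0
    · rw [h0, map_zero, zero_mul, zero_mul, mul_zero]
    · rw [ht h0]
      ring
  have hγ0 : γ = 0 := by
    rw [horth] at hinner
    exact (mul_eq_zero.1 hinner.symm).resolve_right (inner_self_ne_zero.2 hh0)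
  filter_upwards [hfγ] with t ht hne
  rw [ht hne, hγ0, zero_mul]

/-- **The orthogonal complement of an atom inside `V` is again closed under `|·|`**: if `f ∈ V` and
`⟪h, f⟫ = 0` then `⟪h, |f|⟫ = 0`. [folklore] -/
theorem atom_inner_absLp_eq_zero (V : Submodule ℂ (L2T M)) (hVc : ∀ f ∈ V, conjLp f ∈ V)
    (hVa : ∀ f ∈ V, absLp f ∈ V) {h : L2T M} (hh : h ∈ V) (hh0 : h ≠ 0) (hha : absLp h = h)
    (hhe : ∀ k ∈ V, absLp k = k → (∃ C : ℝ, absLp ((C : ℂ) • h - k) = (C : ℂ) • h - k) → ∃ c : ℝ, k = (c : ℂ) • h)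
    {f : L2T M} (hf : f ∈ V) (horth : ⟪h, f⟫_ℂ = 0) : ⟪h, absLp f⟫_ℂ = 0 := by
  have h1 := atom_ae_eq_zero_of_inner_eq_zero V hVc hVa hh hh0 hha hhe hf horth
  rw [L2.inner_def]
  refine integral_eq_zero_of_ae ?_
  filter_upwards [h1, coeFn_absLp f] with t ht habs
  rw [Pi.zero_apply, RCLike.inner_apply', habs]
  by_cases h0 : (h : 𝕋 M → ℂ) t = 0
  · rw [h0, map_zero, zero_mul]
  · rw [ht h0, norm_zero, Complex.ofReal_zero, mul_zero]



/-! ### Diagonal translations: group law and continuity of the matrix coefficients -/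

-- The Haar measure on `(ℝ/ℤ)^{3M}` is translation invariant (instances of `PeriodicMaxFormTranslation.lean`).
attribute [local instance] Literature.MathematicalPhysics.QuantumManyBody.BoseGas.translation_isAddHaarMeasure
  Literature.MathematicalPhysics.QuantumManyBody.BoseGas.translation_isAddRightInvariant

/-- `(0, …, 0)` is the diagonal shift of `0`. [folklore] -/
theorem diagShift_zero : diagShift M (0 : UnitAddTorus (Fin 3)) = 0 := funext fun _ => rfl

/-- `T_0 = id`. [folklore] -/
theorem translateLp_zero (η : L2T M) : translateLp (0 : UnitAddTorus (Fin 3)) η = η := by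
  refine Lp.ext ?_
  filter_upwards [coeFn_translateLp (N := M) 0 η] with t ht
  rw [ht, diagShift_zero, add_zero]

/-- `T_{b'} (T_b η) = η(· + (b',…,b') + (b,…,b))` a.e. [folklore] -/
theorem coeFn_translateLp_translateLp (b b' : UnitAddTorus (Fin 3)) (η : L2T M) :
    ((translateLp b' (translateLp b η) : L2T M) : 𝕋 M → ℂ) =ᵐ[volume]
      fun t => (η : 𝕋 M → ℂ) (t + diagShift M b' + diagShift M b) := by
  have h1 := coeFn_translateLp b' (translateLp b η : L2T M)
  have h2 := (measurePreserving_add_right (volume : Measure (𝕋 M)) (diagShift M b')).quasiMeasurePreserving.ae_eq_comp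
    (coeFn_translateLp b η)
  filter_upwards [h1, h2] with t ht1 ht2
  rw [ht1]
  exact ht2

/-- **Group law** of the diagonal translations: `T_{b'} ∘ T_b = T_{b' + b}`. [folklore] -/
theorem translateLp_translateLp (b b' : UnitAddTorus (Fin 3)) (η : L2T M) :
    translateLp b' (translateLp b η) = translateLp (b' + b) η := by
  refine Lp.ext ?_
  filter_upwards [coeFn_translateLp_translateLp b b' η, coeFn_translateLp (N := M) (b' + b) η] with t h1 h2
  rw [h1, h2, diagShift_add, add_assoc]

/-- `T_{-b} ∘ T_b = id`. [folklore] -/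
theorem translateLp_neg_translateLp (b : UnitAddTorus (Fin 3)) (η : L2T M) :
    translateLp (-b) (translateLp b η) = η := by
  rw [translateLp_translateLp, neg_add_cancel, translateLp_zero]

/-- `T_b ∘ T_{-b} = id`. [folklore] -/
theorem translateLp_translateLp_neg (b : UnitAddTorus (Fin 3)) (η : L2T M) :
    translateLp b (translateLp (-b) η) = η := by
  rw [translateLp_translateLp, add_neg_cancel, translateLp_zero]

/-- **The matrix coefficients of the diagonal translations are continuous**:
`b ↦ ⟪ξ, T_b η⟫ = ∑ₙ e_{∑ᵢ n(i,·)}(b) conj⟪eₙ, ξ⟫ ⟪eₙ, η⟫` is a uniformly absolutely convergent series of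
characters (Parseval). [folklore] -/
theorem continuous_inner_translateLp (ξ η : L2T M) :
    Continuous fun b : UnitAddTorus (Fin 3) => ⟪ξ, translateLp b η⟫_ℂ := by
  have hpt : (fun b : UnitAddTorus (Fin 3) => ⟪ξ, translateLp b η⟫_ℂ) =
      fun b => ∑' n : Fin M × Fin 3 → ℤ, mFourier (fun k => ∑ i, n (i, k)) b *
        (conj ⟪(mFourierLp 2 n : L2T M), ξ⟫_ℂ * ⟪(mFourierLp 2 n : L2T M), η⟫_ℂ) := by
    funext b
    rw [← (hasSum_conj_inner_mul_inner ξ (translateLp b η)).tsum_eq]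
    refine tsum_congr fun n => ?_
    rw [inner_mFourierLp_translateLp]
    ring
  rw [hpt]
  refine continuous_tsum (fun n => (map_continuous (mFourier _)).mul continuous_const)
    (summable_norm_inner_mul_inner ξ η) fun n b => ?_
  rw [norm_mul, Torus.norm_mFourier_apply, one_mul]

/-- **The matrix coefficients of the diagonal translations are continuous** — registered sub-goal form
of `continuous_inner_translateLp` (helper 2/3 of stub D′α `stub_groundStatesTranslationInvariant` of crux
`RecoilTransfer`). [folklore] -/
theorem continuous_translateLp_matrixCoeff :
    ∀ {M : ℕ} (ξ η : Lp ℂ 2 (volume : Measure (UnitAddTorus (Fin M × Fin 3)))),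
      Continuous fun b : UnitAddTorus (Fin 3) => ⟪ξ, translateLp b η⟫_ℂ :=
  fun ξ η => continuous_inner_translateLp ξ η

end Summit.AtomisticToContinuum.BoseEinsteinCondensation.Theorems
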